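import Mathlib.LinearAlgebra.Matrix.PosDef
import Literature.Barriers.AnomalousDissipation.ShearFlowViscositySelectionWild
import HarnessLib

/-!
# Székelyhidi's vortex-sheet subsolution (Székelyhidi 2011, §2): the explicit fields and their
  pointwise properties

Topic `Barriers/AnomalousDissipation`, companion to
`Literature/Barriers/AnomalousDissipation/ShearFlowViscositySelectionWild.lean` (named fact
`Szekelyhidi2011_thm11`, Székelyhidi, C. R. Math. 349 (2011) 1063–1066, Thm. 1.1). This file is
the first layer of the proof of Thm. 1.1 from the convex-integration theorem Thm. 1.3 of the paper
(named fact `Literature.Analysis.FluidPDE.Torus.Szekelyhidi2011_thm13`): the explicit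
subsolution of op. cit. §2, for `n = 2` and the rarefaction speed `λ = ½`.

Printed construction (op. cit. §2, `n = 2`): "`v̄ := (α, 0)`, `ū := [[β, γ], [γ, -β]]`,
`q̄ := β` … `β := ½ α²` and `γ := -(λ/2)(1 - α²)` … (9) becomes the inviscid Burgers equation
`∂ₜα + (λ/2) ∂_{x₂} α² = 0` … Set `α` to be the (unique) viscosity solution, given by a rarefaction
wave with speed `λ` at `x₂ = 0` and constant shocks at `x₂ = ±½` up to time `T = 1/(2λ)`, i.e.
`α(x₂,t) = -1` for `-½ < x₂ < -λt`, `= x₂/(λt)` for `-λt < x₂ < λt`, `= 1` for `λt < x₂ < ½` …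
`{|α| < 1} = U := {(x,t) : |x₂| < λt}` … `ē := ½ - ε (1-λ)/2 (1 - α²)` for some `ε ∈ [0,1)`."

## This file (`λ = ½`, so `T = 1/(2λ) = 1`, `(1-λ)/2 = ¼`, `λ/2 = ¼`)

* `VortexSheet.fanFun t y` — the rarefaction profile on the fundamental interval
  `y ∈ [-½, ½)`: `clamp(2y/t, -1, 1)` for `t > 0` and the datum `sign` for `t ≤ 0`;
  `VortexSheet.α t : UnitAddCircle → ℝ` its `1`-periodic extension (`AddCircle.liftIco`), with
  `α 0 = vortexSheetProfile`;
* `VortexSheet.vbar`, `ubar`, `qbar` — `v̄ = (α(x₂,t), 0)`, `ū = [[β, γ], [γ, -β]]`, `q̄ = β`,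
  `β = α²/2`, `γ = -(1 - α²)/4`;
* `VortexSheet.ebar ε c` — the energy density `ē = ½ - κ (1 - α²)`, `κ = (ε + c α)/4`: for
  `c = 0` this is the printed `ē` (with `λ = ½`); the odd modulation `c α` (which does not change
  `∫ ē(·,t)`, nor the strict/relaxed inequalities as long as `|ε| + |c| < 1`) is used downstream
  to produce infinitely many *distinct* solutions from the mere existence statement of Thm. 1.3;
* `VortexSheet.U = {(t,x) : 0 < t < 1, ‖x₂‖ < t/2}` — the turbulent zone (open);
* pointwise facts: `|α| ≤ 1`, `{|α| < 1} = U` on `(0,1) × T²`, the values of `α` on `U`,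
  continuity of all fields on `U`, measurability, and the matrix algebra of (4), (5), (8):
  `ē Id - (v̄ ⊗ v̄ - ū) = (1 - α²) • [[½ - κ, -¼], [-¼, ½ - κ]]`, positive semidefinite
  everywhere and positive definite exactly on `U` (for `|ε| + |c| < 1`), zero off `U`.

The distributional identities (3) (weak Burgers equation for the rarefaction fan) and the
assembly of Thm. 1.1 are in the sibling files `VortexSheetSubsolutionWeak.lean`,
`VortexSheetWild.lean`.

## References

* L. Székelyhidi Jr., C. R. Math. Acad. Sci. Paris 349 (2011) 1063–1066, §2, (9)–(12)
  (`Szekelyhidi2011`).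
* E. Wiedemann, Dissertation, Bonn 2012, §2.6, proof of Thm. 2.22 (`Wiedemann2012Thesis`).
-/

open MeasureTheory Set Filter Function
open scoped InnerProductSpace
open Literature.Analysis.FunctionSpaces.Torus

noncomputable section

namespace Literature.Barriers.AnomalousDissipation

namespace VortexSheet

/-- The flat two-torus (local notation). -/
local notation "𝕋²" => UnitAddTorus (Fin 2)
/-- `ℝ²` (local notation). -/
local notation "E²" => EuclideanSpace ℝ (Fin 2)

/-! ## The rarefaction profile -/

/-- `clamp1 r = max (-1) (min 1 r)`, the truncation of `r` to `[-1, 1]`. [folklore] -/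
def clamp1 (r : ℝ) : ℝ := max (-1) (min 1 r)

/-- `|clamp1 r| ≤ 1`. [folklore] -/
theorem abs_clamp1_le (r : ℝ) : |clamp1 r| ≤ 1 := by
  unfold clamp1
  rw [abs_le]
  exact ⟨le_max_left _ _, max_le (by norm_num) (min_le_left _ _)⟩

/-- `clamp1 r = r` when `|r| ≤ 1`. [folklore] -/
theorem clamp1_of_abs_le {r : ℝ} (h : |r| ≤ 1) : clamp1 r = r := by
  unfold clamp1
  rw [abs_le] at h
  rw [min_eq_right h.2, max_eq_right h.1]

/-- `clamp1 r = 1` when `1 ≤ r`. [folklore] -/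
theorem clamp1_of_one_le {r : ℝ} (h : 1 ≤ r) : clamp1 r = 1 := by
  unfold clamp1
  rw [min_eq_left h, max_eq_right (by norm_num)]

/-- `clamp1 r = -1` when `r ≤ -1`. [folklore] -/
theorem clamp1_of_le_neg_one {r : ℝ} (h : r ≤ -1) : clamp1 r = -1 := by
  unfold clamp1
  rw [min_eq_right (by linarith), max_eq_left h]

/-- `|clamp1 r| < 1 ↔ |r| < 1`. [folklore] -/
theorem abs_clamp1_lt_one_iff {r : ℝ} : |clamp1 r| < 1 ↔ |r| < 1 := by
  constructor
  · intro h
    by_contra hr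
    rw [not_lt] at hr
    rcases le_abs'.1 hr with hr | hr
    · rw [clamp1_of_le_neg_one hr] at h; norm_num at h
    · rw [clamp1_of_one_le hr] at h; norm_num at h
  · intro h
    rwa [clamp1_of_abs_le h.le]

/-- `clamp1` is continuous. [folklore] -/
theorem continuous_clamp1 : Continuous clamp1 :=
  continuous_const.max (continuous_const.min continuous_id)

/-- **The rarefaction profile on the fundamental interval** (Székelyhidi 2011, (10) with
`λ = ½`): for `t > 0`, `fanFun t y = clamp(2y/t, -1, 1)` (`= -1` for `y ≤ -t/2`, `= 2y/t` for
`|y| ≤ t/2`, `= 1` for `y ≥ t/2`); for `t ≤ 0` the initial datum `sign` (value `-1` at `y ≤ 0`,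
the convention of `vortexSheetProfile`). [cite: Szekelyhidi2011, (10)] -/
def fanFun (t y : ℝ) : ℝ :=
  if 0 < t then clamp1 (2 * y / t) else if 0 < y then 1 else -1

/-- `|fanFun t y| ≤ 1`. [folklore] -/
theorem abs_fanFun_le (t y : ℝ) : |fanFun t y| ≤ 1 := by
  unfold fanFun
  split_ifs
  · exact abs_clamp1_le _
  · simp
  · simp

/-- For `t > 0`, `fanFun t y = clamp1 (2y/t)`. [folklore] -/
theorem fanFun_of_pos {t : ℝ} (ht : 0 < t) (y : ℝ) : fanFun t y = clamp1 (2 * y / t) := by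
  simp [fanFun, ht]

/-- In the fan, `fanFun t y = 2y/t` (`t > 0`, `|y| ≤ t/2`). [cite: Szekelyhidi2011, (10)] -/
theorem fanFun_of_abs_le {t y : ℝ} (ht : 0 < t) (hy : |y| ≤ t / 2) : fanFun t y = 2 * y / t := by
  rw [fanFun_of_pos ht]
  refine clamp1_of_abs_le ?_
  rw [abs_div, abs_mul, abs_of_pos ht, abs_two, div_le_one ht]
  linarith

/-- Right of the fan, `fanFun t y = 1` (`t > 0`, `y ≥ t/2`). [cite: Szekelyhidi2011, (10)] -/
theorem fanFun_of_ge {t y : ℝ} (ht : 0 < t) (hy : t / 2 ≤ y) : fanFun t y = 1 := by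
  rw [fanFun_of_pos ht]
  refine clamp1_of_one_le ?_
  rw [le_div_iff₀ ht]
  linarith

/-- Left of the fan, `fanFun t y = -1` (`t > 0`, `y ≤ -t/2`). [cite: Szekelyhidi2011, (10)] -/
theorem fanFun_of_le {t y : ℝ} (ht : 0 < t) (hy : y ≤ -(t / 2)) : fanFun t y = -1 := by
  rw [fanFun_of_pos ht]
  refine clamp1_of_le_neg_one ?_
  rw [div_le_iff₀ ht]
  linarith

/-- For `t > 0`: `|fanFun t y| < 1 ↔ |y| < t/2`. [cite: Szekelyhidi2011, §2 "{|α| < 1} = U"] -/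
theorem abs_fanFun_lt_one_iff {t : ℝ} (ht : 0 < t) (y : ℝ) : |fanFun t y| < 1 ↔ |y| < t / 2 := by
  rw [fanFun_of_pos ht, abs_clamp1_lt_one_iff, abs_div, abs_mul, abs_of_pos ht, abs_two,
    div_lt_one ht]
  constructor <;> intro h <;> linarith

/-- `fanFun` is continuous on `{t > 0} × ℝ`. [folklore] -/
theorem continuousOn_fanFun : ContinuousOn (uncurry fanFun) (Ioi 0 ×ˢ univ) := by
  have h : ContinuousOn (fun p : ℝ × ℝ => clamp1 (2 * p.2 / p.1)) (Ioi 0 ×ˢ univ) := by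
    refine continuous_clamp1.comp_continuousOn ?_
    refine ContinuousOn.div (by fun_prop) continuousOn_fst fun p hp => ?_
    exact ne_of_gt (mem_Ioi.1 hp.1)
  refine h.congr fun p hp => ?_
  simp [uncurry, fanFun, mem_Ioi.1 hp.1]

/-- `fanFun` is (jointly) measurable. [folklore] -/
theorem measurable_fanFun : Measurable (uncurry fanFun) := by
  have h1 : Measurable fun p : ℝ × ℝ => clamp1 (2 * p.2 / p.1) :=
    continuous_clamp1.measurable.comp ((measurable_const.mul measurable_snd).div measurable_fst)
  have h2 : Measurable fun p : ℝ × ℝ => if 0 < p.2 then (1 : ℝ) else -1 :=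
    Measurable.ite (measurableSet_lt measurable_const measurable_snd) measurable_const
      measurable_const
  have h : uncurry fanFun = fun p : ℝ × ℝ =>
      if 0 < p.1 then clamp1 (2 * p.2 / p.1) else if 0 < p.2 then (1 : ℝ) else -1 := by
    funext p
    simp [uncurry, fanFun]
  rw [h]
  exact Measurable.ite (measurableSet_lt measurable_const measurable_fst) h1 h2

/-! ## The profile on the circle -/

/-- **The rarefaction-fan solution `α(·, t)` on the circle `T¹ = ℝ/ℤ`** (Székelyhidi 2011, (10),
`λ = ½`): the `1`-periodic extension of `fanFun t` from the fundamental interval `[-½, ½)`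
(`AddCircle.liftIco`). At `t = 0` it is the vortex-sheet profile `vortexSheetProfile`.
[cite: Szekelyhidi2011, (10)] -/
def α (t : ℝ) : UnitAddCircle → ℝ :=
  AddCircle.liftIco 1 (-(1 / 2 : ℝ)) (fanFun t)

/-- `α(·, 0)` is the vortex-sheet profile. [cite: Szekelyhidi2011, (1) and (10)] -/
theorem α_zero : α 0 = vortexSheetProfile := by
  unfold α vortexSheetProfile
  congr 1
  funext y
  simp [fanFun]

/-- `α t s = fanFun t (rep s)` with `rep s ∈ [-½, ½)` the representative
(`AddCircle.equivIco`). [folklore] -/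
theorem α_eq_fanFun_equivIco (t : ℝ) (s : UnitAddCircle) :
    α t s = fanFun t (AddCircle.equivIco 1 (-(1 / 2 : ℝ)) s) := rfl

/-- On representatives: `α t ↑y = fanFun t y` for `y ∈ [-½, ½)`. [folklore] -/
theorem α_coe {t y : ℝ} (hy : y ∈ Ico (-(1 / 2 : ℝ)) (1 / 2)) :
    α t (y : UnitAddCircle) = fanFun t y := by
  have hy' : y ∈ Ico (-(1 / 2 : ℝ)) (-(1 / 2 : ℝ) + 1) := by norm_num; exact hy
  exact AddCircle.liftIco_coe_apply hy'

/-- `|α| ≤ 1` (Székelyhidi 2011, §2: "we have `|α| ≤ 1` for all `(x,t)`").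
[cite: Szekelyhidi2011, §2] -/
theorem abs_α_le (t : ℝ) (s : UnitAddCircle) : |α t s| ≤ 1 := by
  rw [α_eq_fanFun_equivIco]
  exact abs_fanFun_le _ _

/-- `α² ≤ 1`. [folklore] -/
theorem α_sq_le (t : ℝ) (s : UnitAddCircle) : α t s ^ 2 ≤ 1 := by
  have h := abs_le.1 (abs_α_le t s)
  nlinarith [h.1, h.2]

/-- `0 ≤ 1 - α²`. [folklore] -/
theorem one_sub_α_sq_nonneg (t : ℝ) (s : UnitAddCircle) : 0 ≤ 1 - α t s ^ 2 := by
  linarith [α_sq_le t s]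

/-- The representative of `s : T¹` in `[-½, ½)` has absolute value `‖s‖`. [folklore] -/
theorem abs_equivIco_eq_norm (s : UnitAddCircle) :
    |((AddCircle.equivIco 1 (-(1 / 2 : ℝ)) s : ℝ))| = ‖s‖ := by
  set y : ℝ := (AddCircle.equivIco 1 (-(1 / 2 : ℝ)) s : ℝ) with hy
  have hmem : y ∈ Ico (-(1 / 2 : ℝ)) (-(1 / 2 : ℝ) + 1) := (AddCircle.equivIco 1 (-(1 / 2 : ℝ)) s).2
  have hs : (y : UnitAddCircle) = s := AddCircle.coe_equivIco
  rw [← hs, UnitAddCircle.norm_eq]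
  have hround : round y = 0 := by
    rw [round_eq, Int.floor_eq_zero_iff]
    constructor <;> linarith [hmem.1, hmem.2]
  simp [hround]

/-- **The turbulent zone is `{|α| < 1}`**: for `t > 0`, `|α t s| < 1 ↔ ‖s‖ < t/2`
(Székelyhidi 2011, §2: "`{|α| < 1} = U := {(x,t) : |x₂| < λt}`"). [cite: Szekelyhidi2011, §2] -/
theorem abs_α_lt_one_iff {t : ℝ} (ht : 0 < t) (s : UnitAddCircle) : |α t s| < 1 ↔ ‖s‖ < t / 2 := by
  rw [α_eq_fanFun_equivIco, abs_fanFun_lt_one_iff ht, abs_equivIco_eq_norm]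

/-- In the turbulent zone `α` is the linear profile of the representative:
`α t s = 2 rep(s) / t` for `‖s‖ ≤ t/2`, `t > 0`. [cite: Szekelyhidi2011, (10)] -/
theorem α_eq_of_norm_le {t : ℝ} (ht : 0 < t) {s : UnitAddCircle} (hs : ‖s‖ ≤ t / 2) :
    α t s = 2 * (AddCircle.equivIco 1 (-(1 / 2 : ℝ)) s : ℝ) / t := by
  rw [α_eq_fanFun_equivIco]
  exact fanFun_of_abs_le ht (by rwa [abs_equivIco_eq_norm])

/-- Off the turbulent zone `α² = 1`: for `t > 0` and `‖s‖ ≥ t/2`. [cite: Szekelyhidi2011, §2] -/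
theorem α_sq_eq_one_of_le_norm {t : ℝ} (ht : 0 < t) {s : UnitAddCircle} (hs : t / 2 ≤ ‖s‖) :
    α t s ^ 2 = 1 := by
  have h1 : ¬ |α t s| < 1 := by rw [abs_α_lt_one_iff ht]; exact not_lt.2 hs
  have h2 : |α t s| = 1 := le_antisymm (abs_α_le t s) (not_lt.1 h1)
  calc α t s ^ 2 = |α t s| ^ 2 := (sq_abs _).symm
    _ = 1 := by rw [h2, one_pow]

/-- `α` is jointly measurable in `(t, s)`. [folklore] -/
theorem measurable_uncurry_α : Measurable (uncurry α) := by
  have h : uncurry α = uncurry fanFun ∘ fun p : ℝ × UnitAddCircle =>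
      (p.1, ((AddCircle.equivIco 1 (-(1 / 2 : ℝ)) p.2 : ℝ))) := by
    funext p; rfl
  rw [h]
  refine measurable_fanFun.comp (measurable_fst.prodMk ?_)
  exact (measurable_subtype_coe.comp
    (AddCircle.measurableEquivIco 1 (-(1 / 2 : ℝ))).measurable).comp measurable_snd

/-- Each `α t` is measurable. [folklore] -/
theorem measurable_α (t : ℝ) : Measurable (α t) :=
  measurable_uncurry_α.comp (measurable_const.prodMk measurable_id)

/-- `α` is continuous at every `(t, s)` with `t > 0` and `s ≠ ½` (the representative map is
continuous off the cut point, `AddCircle.continuousAt_equivIco`). [folklore] -/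
theorem continuousAt_uncurry_α {t : ℝ} (ht : 0 < t) {s : UnitAddCircle}
    (hs : s ≠ ((-(1 / 2 : ℝ) : ℝ) : UnitAddCircle)) : ContinuousAt (uncurry α) (t, s) := by
  have h : uncurry α = uncurry fanFun ∘ fun p : ℝ × UnitAddCircle =>
      (p.1, ((AddCircle.equivIco 1 (-(1 / 2 : ℝ)) p.2 : ℝ))) := by
    funext p; rfl
  rw [h]
  refine ContinuousAt.comp ?_ ?_
  · exact continuousOn_fanFun.continuousAt (prod_mem_nhds (Ioi_mem_nhds ht) univ_mem)
  · have hg : ContinuousAt (fun u : UnitAddCircle =>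
        ((AddCircle.equivIco 1 (-(1 / 2 : ℝ)) u : ℝ))) s :=
      continuous_subtype_val.continuousAt.comp
        (AddCircle.continuousAt_equivIco 1 (-(1 / 2 : ℝ)) hs)
    have h2 : ContinuousAt ((fun u : UnitAddCircle =>
        ((AddCircle.equivIco 1 (-(1 / 2 : ℝ)) u : ℝ))) ∘
          (Prod.snd : ℝ × UnitAddCircle → UnitAddCircle)) (t, s) :=
      ContinuousAt.comp (f := (Prod.snd : ℝ × UnitAddCircle → UnitAddCircle)) (x := (t, s)) hg
        continuousAt_snd
    exact continuousAt_fst.prodMk h2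

/-- Points of the turbulent zone are away from the cut point `½ = -½` of the fundamental
interval (`‖s‖ < t/2 ≤ ½ = ‖½‖`). [folklore] -/
theorem ne_cut_of_norm_lt {t : ℝ} (ht : t ≤ 1) {s : UnitAddCircle} (hs : ‖s‖ < t / 2) :
    s ≠ ((-(1 / 2 : ℝ) : ℝ) : UnitAddCircle) := by
  intro h
  rw [h, UnitAddCircle.norm_eq] at hs
  norm_num at hs
  linarith


/-! ## The fields `v̄`, `ū`, `q̄`, `ē` and the turbulent zone `U` -/

/-- `β = α²/2` (Székelyhidi 2011, §2). [cite: Szekelyhidi2011, §2] -/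
def β (t : ℝ) (s : UnitAddCircle) : ℝ := α t s ^ 2 / 2

/-- `γ = -(λ/2)(1 - α²) = -(1 - α²)/4` for `λ = ½` (Székelyhidi 2011, §2).
[cite: Szekelyhidi2011, §2] -/
def γ (t : ℝ) (s : UnitAddCircle) : ℝ := -(1 - α t s ^ 2) / 4

/-- The modulation `κ = (ε + c α)/4` of the energy density (`c = 0`: the printed
`ε (1-λ)/2 = ε/4`). [cite: Szekelyhidi2011, (11)] -/
def κ (ε c : ℝ) (t : ℝ) (s : UnitAddCircle) : ℝ := (ε + c * α t s) / 4

/-- **`v̄ = (α(x₂, t), 0)`** (Székelyhidi 2011, §2). [cite: Szekelyhidi2011, §2] -/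
def vbar (t : ℝ) (x : 𝕋²) : E² := !₂[α t (x 1), 0]

/-- **`ū = [[β, γ], [γ, -β]]`**, symmetric and trace-free (Székelyhidi 2011, §2).
[cite: Szekelyhidi2011, §2] -/
def ubar (t : ℝ) (x : 𝕋²) : Matrix (Fin 2) (Fin 2) ℝ :=
  !![β t (x 1), γ t (x 1); γ t (x 1), -β t (x 1)]

/-- **`q̄ = β`** (Székelyhidi 2011, §2). [cite: Szekelyhidi2011, §2] -/
def qbar (t : ℝ) (x : 𝕋²) : ℝ := β t (x 1)

/-- **The energy density `ē = ½ - κ (1 - α²)`**, `κ = (ε + c α)/4` (Székelyhidi 2011, (11):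
`ē = ½ - ε (1-λ)/2 (1 - α²)`, here `λ = ½`, plus the odd modulation `c α (1 - α²)/4`).
[cite: Szekelyhidi2011, (11)] -/
def ebar (ε c : ℝ) (t : ℝ) (x : 𝕋²) : ℝ := 1 / 2 - κ ε c t (x 1) * (1 - α t (x 1) ^ 2)

/-- **The turbulent zone** `U = {(t, x) : 0 < t < 1, ‖x₂‖ < t/2}` (Székelyhidi 2011, §2:
`U := {(x,t) : |x₂| < λt}`, `λ = ½`, up to the time `T = 1/(2λ) = 1`).
[cite: Szekelyhidi2011, §2] -/
def U : Set (ℝ × 𝕋²) := {p | 0 < p.1 ∧ p.1 < 1 ∧ ‖p.2 1‖ < p.1 / 2}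

/-- Membership in `U`. [folklore] -/
theorem mem_U {p : ℝ × 𝕋²} : p ∈ U ↔ 0 < p.1 ∧ p.1 < 1 ∧ ‖p.2 1‖ < p.1 / 2 := Iff.rfl

/-- `U` is open. [folklore] -/
theorem isOpen_U : IsOpen U := by
  have h1 : IsOpen {p : ℝ × 𝕋² | 0 < p.1} := isOpen_lt continuous_const continuous_fst
  have h2 : IsOpen {p : ℝ × 𝕋² | p.1 < 1} := isOpen_lt continuous_fst continuous_const
  have h3 : IsOpen {p : ℝ × 𝕋² | ‖p.2 1‖ < p.1 / 2} :=
    isOpen_lt (continuous_norm.comp ((continuous_apply 1).comp continuous_snd))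
      (continuous_fst.div_const _)
  have h : U = ({p : ℝ × 𝕋² | 0 < p.1} ∩ {p | p.1 < 1}) ∩ {p | ‖p.2 1‖ < p.1 / 2} := by
    ext p
    simp only [U, mem_setOf_eq, mem_inter_iff, and_assoc]
  rw [h]
  exact (h1.inter h2).inter h3

/-- `U ⊆ (0,1) × T²`. [folklore] -/
theorem U_subset : U ⊆ Ioo (0 : ℝ) 1 ×ˢ (univ : Set 𝕋²) := by
  rintro ⟨t, x⟩ ⟨h0, h1, -⟩
  exact ⟨⟨h0, h1⟩, mem_univ _⟩

/-- `U` is non-empty (it contains `(½, 0)`). [folklore] -/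
theorem U_nonempty : U.Nonempty :=
  ⟨(1 / 2, 0), by refine ⟨by norm_num, by norm_num, ?_⟩; simp⟩

/-- On `U`, `|α| < 1`. [cite: Szekelyhidi2011, §2] -/
theorem abs_α_lt_one_of_mem_U {p : ℝ × 𝕋²} (hp : p ∈ U) : |α p.1 (p.2 1)| < 1 :=
  (abs_α_lt_one_iff hp.1 _).2 hp.2.2

/-- On `U`, `0 < 1 - α²`. [folklore] -/
theorem one_sub_α_sq_pos_of_mem_U {p : ℝ × 𝕋²} (hp : p ∈ U) : 0 < 1 - α p.1 (p.2 1) ^ 2 := by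
  have h := abs_lt.1 (abs_α_lt_one_of_mem_U hp)
  nlinarith [h.1, h.2]

/-- Off `U` (at times `0 < t < 1`), `α² = 1`. [cite: Szekelyhidi2011, §2] -/
theorem α_sq_eq_one_of_not_mem_U {t : ℝ} (ht : 0 < t) (ht1 : t < 1) {x : 𝕋²} (h : (t, x) ∉ U) :
    α t (x 1) ^ 2 = 1 := by
  refine α_sq_eq_one_of_le_norm ht (not_lt.1 fun h' => h ⟨ht, ht1, h'⟩)

/-! ### Pointwise bounds -/

/-- `|κ| ≤ (|ε| + |c|)/4`. [folklore] -/
theorem abs_κ_le (ε c t : ℝ) (s : UnitAddCircle) : |κ ε c t s| ≤ (|ε| + |c|) / 4 := by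
  unfold κ
  rw [abs_div, abs_of_pos (by norm_num : (0 : ℝ) < 4)]
  gcongr
  calc |ε + c * α t s| ≤ |ε| + |c * α t s| := abs_add_le _ _
    _ ≤ |ε| + |c| := by
      rw [abs_mul]
      nlinarith [abs_α_le t s, abs_nonneg c]

/-- `κ < ¼` when `|ε| + |c| < 1`. [folklore] -/
theorem κ_lt_quarter {ε c : ℝ} (h : |ε| + |c| < 1) (t : ℝ) (s : UnitAddCircle) :
    κ ε c t s < 1 / 4 := by
  have := (abs_le.1 (abs_κ_le ε c t s)).2
  linarith

/-- `ē ≥ ¼` when `|ε| + |c| ≤ 1` (so in particular `ē ≥ 0`). [folklore] -/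
theorem quarter_le_ebar {ε c : ℝ} (h : |ε| + |c| ≤ 1) (t : ℝ) (x : 𝕋²) :
    1 / 4 ≤ ebar ε c t x := by
  unfold ebar
  have hκ := (abs_le.1 (abs_κ_le ε c t (x 1))).2
  have h1 := one_sub_α_sq_nonneg t (x 1)
  have h2 : 1 - α t (x 1) ^ 2 ≤ 1 := by nlinarith [sq_nonneg (α t (x 1))]
  nlinarith

/-- `ē ≤ ¾` when `|ε| + |c| ≤ 1`. [folklore] -/
theorem ebar_le {ε c : ℝ} (h : |ε| + |c| ≤ 1) (t : ℝ) (x : 𝕋²) : ebar ε c t x ≤ 3 / 4 := by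
  unfold ebar
  have hκ := (abs_le.1 (abs_κ_le ε c t (x 1))).1
  have h1 := one_sub_α_sq_nonneg t (x 1)
  have h2 : 1 - α t (x 1) ^ 2 ≤ 1 := by nlinarith [sq_nonneg (α t (x 1))]
  nlinarith

/-- `ē = ½` where `α² = 1` (off the turbulent zone). [cite: Szekelyhidi2011, (11)] -/
theorem ebar_eq_half_of_α_sq {ε c t : ℝ} {x : 𝕋²} (h : α t (x 1) ^ 2 = 1) :
    ebar ε c t x = 1 / 2 := by
  simp [ebar, h]

/-- `‖v̄‖² = α²`. [folklore] -/
theorem norm_vbar_sq (t : ℝ) (x : 𝕋²) : ‖vbar t x‖ ^ 2 = α t (x 1) ^ 2 := by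
  rw [vbar, EuclideanSpace.norm_sq_eq, Fin.sum_univ_two]
  simp

/-- `‖v̄‖ ≤ 1`. [cite: Szekelyhidi2011, §2] -/
theorem norm_vbar_le (t : ℝ) (x : 𝕋²) : ‖vbar t x‖ ≤ 1 := by
  have h : ‖vbar t x‖ ^ 2 ≤ 1 := by rw [norm_vbar_sq]; exact α_sq_le _ _
  nlinarith [norm_nonneg (vbar t x)]

/-- The components of `v̄`. [folklore] -/
@[simp] theorem vbar_apply_zero (t : ℝ) (x : 𝕋²) : vbar t x 0 = α t (x 1) := by simp [vbar]
/-- The components of `v̄`. [folklore] -/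
@[simp] theorem vbar_apply_one (t : ℝ) (x : 𝕋²) : vbar t x 1 = 0 := by simp [vbar]

/-- The entries of `ū`. [folklore] -/
@[simp] theorem ubar_apply_00 (t : ℝ) (x : 𝕋²) : ubar t x 0 0 = β t (x 1) := rfl
/-- The entries of `ū`. [folklore] -/
@[simp] theorem ubar_apply_01 (t : ℝ) (x : 𝕋²) : ubar t x 0 1 = γ t (x 1) := rfl
/-- The entries of `ū`. [folklore] -/
@[simp] theorem ubar_apply_10 (t : ℝ) (x : 𝕋²) : ubar t x 1 0 = γ t (x 1) := rfl
/-- The entries of `ū`. [folklore] -/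
@[simp] theorem ubar_apply_11 (t : ℝ) (x : 𝕋²) : ubar t x 1 1 = -β t (x 1) := rfl

/-- `ū` is symmetric. [cite: Szekelyhidi2011, §2] -/
theorem ubar_isSymm (t : ℝ) (x : 𝕋²) : (ubar t x).IsSymm := by
  ext i j; fin_cases i <;> fin_cases j <;> rfl

/-- `ū` is trace-free. [cite: Szekelyhidi2011, §2] -/
theorem trace_ubar (t : ℝ) (x : 𝕋²) : (ubar t x).trace = 0 := by
  simp [Matrix.trace, Fin.sum_univ_two]

/-- `|β| ≤ ½`. [folklore] -/
theorem abs_β_le (t : ℝ) (s : UnitAddCircle) : |β t s| ≤ 1 / 2 := by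
  unfold β
  rw [abs_div, abs_of_pos (by norm_num : (0:ℝ) < 2), abs_of_nonneg (sq_nonneg _)]
  linarith [α_sq_le t s]

/-- `|γ| ≤ ¼`. [folklore] -/
theorem abs_γ_le (t : ℝ) (s : UnitAddCircle) : |γ t s| ≤ 1 / 4 := by
  unfold γ
  rw [abs_div, abs_of_pos (by norm_num : (0:ℝ) < 4), abs_neg,
    abs_of_nonneg (one_sub_α_sq_nonneg t s)]
  have : 1 - α t s ^ 2 ≤ 1 := by nlinarith [sq_nonneg (α t s)]
  linarith

/-- `|ū i j| ≤ ½`. [folklore] -/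
theorem abs_ubar_le (t : ℝ) (x : 𝕋²) (i j : Fin 2) : |ubar t x i j| ≤ 1 / 2 := by
  fin_cases i <;> fin_cases j
  · exact abs_β_le _ _
  · exact (abs_γ_le _ _).trans (by norm_num)
  · exact (abs_γ_le _ _).trans (by norm_num)
  · simp only [ubar_apply_11, Fin.mk_one, Fin.isValue, abs_neg]; exact abs_β_le _ _

/-- `|q̄| ≤ ½`. [folklore] -/
theorem abs_qbar_le (t : ℝ) (x : 𝕋²) : |qbar t x| ≤ 1 / 2 := abs_β_le _ _


/-! ### Continuity on the turbulent zone -/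

/-- `(t, x) ↦ α t (x 1)` is continuous at every point of `U`. [folklore] -/
theorem continuousAt_α_snd {p : ℝ × 𝕋²} (hp : p ∈ U) :
    ContinuousAt (fun q : ℝ × 𝕋² => α q.1 (q.2 1)) p := by
  have h1 : ContinuousAt (uncurry α) (p.1, p.2 1) :=
    continuousAt_uncurry_α hp.1 (ne_cut_of_norm_lt hp.2.1.le hp.2.2)
  have h2 : ContinuousAt (fun q : ℝ × 𝕋² => (q.1, q.2 1)) p :=
    (continuous_fst.prodMk ((continuous_apply 1).comp continuous_snd)).continuousAt
  exact ContinuousAt.comp (f := fun q : ℝ × 𝕋² => (q.1, q.2 1)) (x := p) h1 h2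

/-- A continuous scalar function of `α(t, x₂)` is continuous on `U`. [folklore] -/
theorem continuousOn_comp_α {g : ℝ → ℝ} (hg : Continuous g) :
    ContinuousOn (fun q : ℝ × 𝕋² => g (α q.1 (q.2 1))) U := fun _ hp =>
  (hg.continuousAt.comp (continuousAt_α_snd hp)).continuousWithinAt

/-- `v̄` is continuous on `U`. [cite: Szekelyhidi2011, Thm. 1.4 hypotheses, verified in §2] -/
theorem continuousOn_vbar : ContinuousOn (uncurry vbar) U := by
  have h : uncurry vbar = (EuclideanSpace.equiv (Fin 2) ℝ).symm ∘
      fun q : ℝ × 𝕋² => ![α q.1 (q.2 1), 0] := by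
    funext q
    rfl
  rw [h]
  refine (EuclideanSpace.equiv (Fin 2) ℝ).symm.continuous.comp_continuousOn ?_
  refine continuousOn_pi.2 fun i => ?_
  fin_cases i
  · exact continuousOn_comp_α continuous_id
  · exact continuousOn_const

/-- The entries of `ū` are continuous on `U`.
[cite: Szekelyhidi2011, Thm. 1.4 hypotheses, verified in §2] -/
theorem continuousOn_ubar (i j : Fin 2) :
    ContinuousOn (fun q : ℝ × 𝕋² => ubar q.1 q.2 i j) U := by
  have hβ : ContinuousOn (fun q : ℝ × 𝕋² => β q.1 (q.2 1)) U :=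
    continuousOn_comp_α (g := fun a => a ^ 2 / 2) (by fun_prop)
  have hγ : ContinuousOn (fun q : ℝ × 𝕋² => γ q.1 (q.2 1)) U :=
    continuousOn_comp_α (g := fun a => -(1 - a ^ 2) / 4) (by fun_prop)
  fin_cases i <;> fin_cases j
  · exact hβ
  · exact hγ
  · exact hγ
  · exact hβ.neg

/-- `q̄` is continuous on `U`. [cite: Szekelyhidi2011, Thm. 1.4 hypotheses, verified in §2] -/
theorem continuousOn_qbar : ContinuousOn (uncurry qbar) U :=
  continuousOn_comp_α (g := fun a => a ^ 2 / 2) (by fun_prop)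

/-- `ē` is continuous on `U`. [cite: Szekelyhidi2011, Thm. 1.4 hypotheses, verified in §2] -/
theorem continuousOn_ebar (ε c : ℝ) : ContinuousOn (uncurry (ebar ε c)) U :=
  continuousOn_comp_α (g := fun a => 1 / 2 - (ε + c * a) / 4 * (1 - a ^ 2)) (by fun_prop)

/-! ### Measurability -/

/-- `(t, x) ↦ α t (x 1)` is measurable. [folklore] -/
theorem measurable_α_snd : Measurable fun q : ℝ × 𝕋² => α q.1 (q.2 1) := by
  have h : (fun q : ℝ × 𝕋² => α q.1 (q.2 1)) = uncurry α ∘ fun q : ℝ × 𝕋² => (q.1, q.2 1) := rfl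
  rw [h]
  exact measurable_uncurry_α.comp
    (measurable_fst.prodMk ((measurable_pi_apply 1).comp measurable_snd))

/-- `v̄` is jointly measurable. [folklore] -/
theorem measurable_vbar : Measurable (uncurry vbar) := by
  have h : uncurry vbar = (EuclideanSpace.equiv (Fin 2) ℝ).symm ∘
      fun q : ℝ × 𝕋² => ![α q.1 (q.2 1), 0] := by
    funext q
    rfl
  rw [h]
  refine (EuclideanSpace.equiv (Fin 2) ℝ).symm.continuous.measurable.comp
    (measurable_pi_lambda _ fun i => ?_)
  fin_cases i
  · exact measurable_α_snd
  · exact measurable_const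

/-- Each slice `v̄ t` is measurable. [folklore] -/
theorem measurable_vbar_slice (t : ℝ) : Measurable (vbar t) :=
  measurable_vbar.comp (measurable_const.prodMk measurable_id)

/-- The entries of `ū` are jointly measurable. [folklore] -/
theorem measurable_ubar (i j : Fin 2) : Measurable fun q : ℝ × 𝕋² => ubar q.1 q.2 i j := by
  have hβ : Measurable fun q : ℝ × 𝕋² => β q.1 (q.2 1) :=
    (continuous_pow 2 |>.div_const 2).measurable.comp measurable_α_snd
  have hγ : Measurable fun q : ℝ × 𝕋² => γ q.1 (q.2 1) :=
    (show Continuous fun a : ℝ => -(1 - a ^ 2) / 4 by fun_prop).measurable.comp measurable_α_snd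
  fin_cases i <;> fin_cases j
  · exact hβ
  · exact hγ
  · exact hγ
  · exact hβ.neg

/-- `q̄` is jointly measurable. [folklore] -/
theorem measurable_qbar : Measurable (uncurry qbar) :=
  (continuous_pow 2 |>.div_const 2).measurable.comp measurable_α_snd

/-- `ē` is jointly measurable. [folklore] -/
theorem measurable_ebar (ε c : ℝ) : Measurable (uncurry (ebar ε c)) :=
  (show Continuous fun a : ℝ => 1 / 2 - (ε + c * a) / 4 * (1 - a ^ 2) by fun_prop).measurable.comp
    measurable_α_snd

/-! ### The relaxed / strict constitutive relations (4), (5), (8) -/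

/-- **The defect matrix** `ē Id - (v̄ ⊗ v̄ - ū) = (1 - α²) • [[½ - κ, -¼], [-¼, ½ - κ]]`
(the computation behind "with this choice of `U` and `ē` the triple `(v̄, ū, q̄)` satisfies (8)
for all time", Székelyhidi 2011, §2). [cite: Szekelyhidi2011, §2] -/
theorem defect_eq (ε c t : ℝ) (x : 𝕋²) :
    (ebar ε c t x) • (1 : Matrix (Fin 2) (Fin 2) ℝ) -
        (Matrix.vecMulVec (vbar t x) (vbar t x) - ubar t x) =
      (1 - α t (x 1) ^ 2) •
        !![1 / 2 - κ ε c t (x 1), -(1 / 4 : ℝ); -(1 / 4 : ℝ), 1 / 2 - κ ε c t (x 1)] := by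
  ext i j
  fin_cases i <;> fin_cases j <;>
    simp [Matrix.vecMulVec_apply, ubar, β, γ, ebar] <;> ring

/-- The quadratic form of the model matrix `[[a, -¼], [-¼, a]]`:
`xᵀ N x = a (x₀² + x₁²) - ½ x₀ x₁`. [folklore] -/
theorem dotProduct_model_mulVec (a : ℝ) (y : Fin 2 → ℝ) :
    y ⬝ᵥ (!![a, -(1 / 4 : ℝ); -(1 / 4 : ℝ), a]).mulVec y =
      a * (y 0 ^ 2 + y 1 ^ 2) - (1 / 2) * y 0 * y 1 := by
  simp [Matrix.mulVec, dotProduct, Fin.sum_univ_two]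
  ring

/-- The defect matrix is Hermitian (real symmetric). [folklore] -/
theorem defect_isHermitian (ε c t : ℝ) (x : 𝕋²) :
    ((ebar ε c t x) • (1 : Matrix (Fin 2) (Fin 2) ℝ) -
        (Matrix.vecMulVec (vbar t x) (vbar t x) - ubar t x)).IsHermitian := by
  rw [defect_eq]
  ext i j
  fin_cases i <;> fin_cases j <;> simp [Matrix.conjTranspose]

/-- **(4): `v̄ ⊗ v̄ - ū ≤ ē Id` everywhere**, for `|ε| + |c| ≤ 1`: the defect is
`(1 - α²) • N`, `1 - α² ≥ 0`, and `xᵀ N x = (a - ¼)|x|² + ¼ (x₀ - x₁)² ≥ 0` since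
`a = ½ - κ ≥ ¼`. [cite: Szekelyhidi2011, §2 (verification of (8))] -/
theorem defect_posSemidef {ε c : ℝ} (h : |ε| + |c| ≤ 1) (t : ℝ) (x : 𝕋²) :
    ((ebar ε c t x) • (1 : Matrix (Fin 2) (Fin 2) ℝ) -
        (Matrix.vecMulVec (vbar t x) (vbar t x) - ubar t x)).PosSemidef := by
  refine Matrix.PosSemidef.of_dotProduct_mulVec_nonneg (defect_isHermitian ε c t x) fun y => ?_
  rw [defect_eq, Matrix.smul_mulVec, dotProduct_smul, star_trivial, dotProduct_model_mulVec,
    smul_eq_mul]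
  have hκ := (abs_le.1 (abs_κ_le ε c t (x 1))).2
  have ha : 1 / 4 ≤ 1 / 2 - κ ε c t (x 1) := by linarith
  have hq : 0 ≤ (1 / 2 - κ ε c t (x 1)) * (y 0 ^ 2 + y 1 ^ 2) - 1 / 2 * y 0 * y 1 := by
    nlinarith [sq_nonneg (y 0 - y 1), sq_nonneg (y 0), sq_nonneg (y 1)]
  exact mul_nonneg (one_sub_α_sq_nonneg t (x 1)) hq

/-- **(5)/(8a): `v̄ ⊗ v̄ - ū < ē Id` on `U`**, for `|ε| + |c| < 1`: there `1 - α² > 0` and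
`a = ½ - κ > ¼`. [cite: Szekelyhidi2011, §2 (verification of (8))] -/
theorem defect_posDef {ε c : ℝ} (h : |ε| + |c| < 1) {p : ℝ × 𝕋²} (hp : p ∈ U) :
    ((ebar ε c p.1 p.2) • (1 : Matrix (Fin 2) (Fin 2) ℝ) -
        (Matrix.vecMulVec (vbar p.1 p.2) (vbar p.1 p.2) - ubar p.1 p.2)).PosDef := by
  refine Matrix.PosDef.of_dotProduct_mulVec_pos (defect_isHermitian ε c p.1 p.2) fun y hy => ?_
  rw [defect_eq, Matrix.smul_mulVec, dotProduct_smul, star_trivial, dotProduct_model_mulVec,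
    smul_eq_mul]
  have hκ := κ_lt_quarter h p.1 (p.2 1)
  have hy' : 0 < y 0 ^ 2 + y 1 ^ 2 := by
    by_contra h0
    apply hy
    have h0' : y 0 ^ 2 + y 1 ^ 2 = 0 := le_antisymm (not_lt.1 h0) (by positivity)
    have h00 : y 0 = 0 := by nlinarith [sq_nonneg (y 0), sq_nonneg (y 1)]
    have h11 : y 1 = 0 := by nlinarith [sq_nonneg (y 0), sq_nonneg (y 1)]
    funext i; fin_cases i <;> simp [h00, h11]
  have hq : 0 < (1 / 2 - κ ε c p.1 (p.2 1)) * (y 0 ^ 2 + y 1 ^ 2) - 1 / 2 * y 0 * y 1 := by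
    nlinarith [sq_nonneg (y 0 - y 1)]
  exact mul_pos (one_sub_α_sq_pos_of_mem_U hp) hq

/-- **(8b): `v̄ ⊗ v̄ - ū = ē Id` off `U`** (where `α² = 1`).
[cite: Szekelyhidi2011, §2 (verification of (8))] -/
theorem defect_eq_zero_of_α_sq {ε c t : ℝ} {x : 𝕋²} (h : α t (x 1) ^ 2 = 1) :
    (ebar ε c t x) • (1 : Matrix (Fin 2) (Fin 2) ℝ) -
        (Matrix.vecMulVec (vbar t x) (vbar t x) - ubar t x) = 0 := by
  rw [defect_eq, h, sub_self, zero_smul]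

/-- (8b) in the form `v̄ ⊗ v̄ - ū = ē Id` off `U`, at times `0 < t < 1`.
[cite: Szekelyhidi2011, §2] -/
theorem vecMulVec_sub_ubar_of_not_mem_U {ε c t : ℝ} (ht : 0 < t) (ht1 : t < 1) {x : 𝕋²}
    (hx : (t, x) ∉ U) :
    Matrix.vecMulVec (vbar t x) (vbar t x) - ubar t x =
      (ebar ε c t x) • (1 : Matrix (Fin 2) (Fin 2) ℝ) := by
  have h := defect_eq_zero_of_α_sq (ε := ε) (c := c) (α_sq_eq_one_of_not_mem_U ht ht1 hx)
  exact (sub_eq_zero.1 h).symm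

end VortexSheet

end Literature.Barriers.AnomalousDissipation
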